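import Literature.NumberTheory.GaussSums.AdditiveCharacterExpansion

/-!
# Katz (1988), Ch. 4 §4.0: Kloosterman sums are the multiplicative Fourier transforms of MONOMIALS IN GAUSS SUMS —
# `Σ_χ g(ψ,χ)ⁿ·χ(a⁻¹) = (q − 1)·Klₙ(ψ; a)` (table line 2, p. 43), PROVED over `ℤ/Nℤ`; and the prime-field corollary
# `Σ_{χ ≠ 1} g(ψ,χ)ⁿ·χ̄(a) = (p − 1)·Klₙ(ψ; a) − (−1)ⁿ` (the «Gauss-count rule»)

N. M. Katz, *Gauss Sums, Kloosterman Sums, and Monodromy Groups*, Annals of Mathematics Studies 116, Princeton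
(1988) [Katz1988], Chapter 4, §4.0 (pp. 42–44): for a finite field `𝔽_q`, a non-trivial additive character `ψ` and
the multiplicative Fourier transform `f̂(χ) = Σ_{a ∈ 𝔽_q^×} f(a)χ(a)` with inversion
`f(a) = (q−1)⁻¹ Σ_χ f̂(χ)χ(a⁻¹)` (pp. 42–43), the table on p. 43 records (line 2) that the function
`f(a) = Σ_{x₁⋯xₙ = a, xᵢ ∈ 𝔽_q^×} ψ(x₁ + ⋯ + xₙ)` — the hyper-Kloosterman sum `Kl(ψ; 1,…,1; 1,…,1)(𝔽_q, a)` of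
§4.0 p. 44 — has Fourier transform `f̂(χ) = g(ψ,χ)ⁿ`, a MONOMIAL IN GAUSS SUMS («Kloosterman sums occur naturally as the
inverse Fourier transforms of monomials in gauss sums», p. 43).

THIS FILE PROVES (sorry-free, from Mathlib's `gaussSum` and `DirichletCharacter` orthogonality):
* `gaussSum_pow_eq_sum` — `g(ψ,χ)ⁿ = Σ_{x : Fin n → ℤ/N} χ(∏ xᵢ)·ψ(Σ xᵢ)` (the `n`-fold expansion);
* `sum_gaussSum_pow_mul_inv` — **Katz's line 2 in inversion form over `ℤ/Nℤ`**: for a unit `a`,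
  `Σ_{χ mod N} g(ψ,χ)ⁿ·χ(a⁻¹) = φ(N)·Klₙ(ψ; a)` where `Klₙ(ψ; a) = hyperKloosterman n ψ a := Σ_{∏ xᵢ = a} ψ(Σ xᵢ)`
  (for a unit `a` the constraint forces every `xᵢ` to be a unit, so this is Katz's sum over `(𝔽_p^×)ⁿ` when `N = p`);
* `sum_ne_one_gaussSum_pow_mul_inv` — **the prime-field corollary with the trivial character removed**:
  `Σ_{χ ≠ 1} g(ψ,χ)ⁿ·χ(a⁻¹) = (p − 1)·Klₙ(ψ; a) − (−1)ⁿ` (`g(ψ,1) = −1`, Mathlib `gaussSum_one_left`).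
Companion BY NAME of `AdditiveCharacterExpansion.lean` (same namespace: `stdAddChar_ne_one`, and the `n = 1` instance
`sum_nontrivial_gaussSum_inv_mul_apply_mul_inv_apply` = Zhang's display «Σ*_ψ τ(ψ̄)ψ(l)ψ̄(k) = p e(lk̄/p) + O(1)»).
USE (cell landau-siegel §D, card `z-degree-toeplitz-band`, typing-spec item 4 «Gauss-count rule»): averaging a product
of `n` Gauss sums `τ(ψ)ⁿ` against `ψ̄(a)` over the non-trivial characters `ψ (mod p)` produces a hyper-Kloosterman
sum of `n` variables (pure of weight `n − 1` by Deligne — Katz Thm 4.1.1 (1), NOT used or stated here) plus the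
trivial-character correction: the recipe's «net Gauss-sum power `0` ⇔ evaluable, `≥ 1` ⇔ Kloosterman-dark»
bookkeeping. No named facts; net debt 0.

## References
* N. M. Katz, *Gauss Sums, Kloosterman Sums, and Monodromy Groups* (1988), Ch. 4 §4.0, pp. 42–44 (table line 2, p. 43;
  definition of `Kl(ψ; χ₁,…,χₙ; b₁,…,bₙ)(𝔽_q, a)`, p. 44). [cite: Katz1988, Ch. 4 §4.0, p. 43 table line 2; p. 44]
-/

noncomputable section

open Finset

namespace Literature.NumberTheory.GaussSums

/-! ### The hyper-Kloosterman sum of `n` variables and the `n`-fold expansion of a Gauss-sum power -/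

section General

variable {N : ℕ} [NeZero N]

/-- **Katz's `Kl(ψ; 1,…,1; 1,…,1)(ℤ/N, a)`** — the hyper-Kloosterman sum of `n` variables
`Klₙ(ψ; a) = Σ_{x₁⋯xₙ = a} ψ(x₁ + ⋯ + xₙ)`, the sum over ALL `x : Fin n → ℤ/Nℤ` with `∏ xᵢ = a` (for a unit `a`
every `xᵢ` is then a unit, Katz's range `xᵢ ∈ 𝔽_q^×`; `n = 2`, `ψ = e(·/p)`: the classical Kloosterman sum
`S(1, a; p)`; `n = 1`: `ψ(a)`; `n = 0`: `[a = 1]`). [cite: Katz1988, Ch. 4 §4.0, p. 44] -/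
def hyperKloosterman (n : ℕ) (ψ : AddChar (ZMod N) ℂ) (a : ZMod N) : ℂ :=
  ∑ x ∈ (univ : Finset (Fin n → ZMod N)).filter (fun x => ∏ i, x i = a), ψ (∑ i, x i)

omit [NeZero N] in
/-- an additive character turns finite sums into products (bookkeeping). [cite: Katz1988, Ch. 4 §4.0, p. 43] -/
theorem addChar_map_sum {ι : Type*} (ψ : AddChar (ZMod N) ℂ) (s : Finset ι) (f : ι → ZMod N) :
    ψ (∑ i ∈ s, f i) = ∏ i ∈ s, ψ (f i) := by
  classical
  induction s using Finset.induction_on with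
  | empty => simp [AddChar.map_zero_eq_one]
  | insert a s ha ih => rw [sum_insert ha, prod_insert ha, AddChar.map_add_eq_mul, ih]

/-- **The `n`-fold expansion of a Gauss-sum power:** `g(ψ,χ)ⁿ = Σ_{x : Fin n → ℤ/N} χ(∏ᵢ xᵢ)·ψ(Σᵢ xᵢ)` (expand the
`n`-th power of `Σ_y χ(y)ψ(y)`; multiplicativity of `χ`, additivity of `ψ` — Katz's «`n`-fold convolution», p. 43).
[cite: Katz1988, Ch. 4 §4.0, p. 43] -/
theorem gaussSum_pow_eq_sum (χ : DirichletCharacter ℂ N) (ψ : AddChar (ZMod N) ℂ) (n : ℕ) :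
    gaussSum χ ψ ^ n = ∑ x : Fin n → ZMod N, χ (∏ i, x i) * ψ (∑ i, x i) := by
  classical
  have h1 : gaussSum χ ψ ^ n = ∏ _i : Fin n, ∑ y : ZMod N, χ y * ψ y := by
    rw [prod_const, card_univ, Fintype.card_fin]; rfl
  rw [h1, prod_univ_sum, Fintype.piFinset_univ]
  refine sum_congr rfl fun x _ => ?_
  rw [prod_mul_distrib, map_prod, addChar_map_sum]

/-- **Katz, Ch. 4 §4.0, table line 2 (inversion form), over `ℤ/Nℤ` (proved):** for a unit `a`,
`Σ_{χ mod N} g(ψ,χ)ⁿ · χ(a⁻¹) = φ(N) · Klₙ(ψ; a)` — the multiplicative Fourier transform of the hyper-Kloosterman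
sum is the monomial `g(ψ,χ)ⁿ` (orthogonality of Dirichlet characters, Mathlib `sum_char_inv_mul_char_eq`).
[cite: Katz1988, Ch. 4 §4.0, p. 43 table line 2] -/
theorem sum_gaussSum_pow_mul_inv (ψ : AddChar (ZMod N) ℂ) (n : ℕ) {a : ZMod N} (ha : IsUnit a) :
    ∑ χ : DirichletCharacter ℂ N, gaussSum χ ψ ^ n * χ a⁻¹ = (N.totient : ℂ) * hyperKloosterman n ψ a := by
  classical
  simp_rw [gaussSum_pow_eq_sum, sum_mul]
  rw [sum_comm]
  have key : ∀ x : Fin n → ZMod N,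
      ∑ χ : DirichletCharacter ℂ N, χ (∏ i, x i) * ψ (∑ i, x i) * χ a⁻¹ =
        (if a = ∏ i, x i then (N.totient : ℂ) else 0) * ψ (∑ i, x i) := by
    intro x
    rw [← DirichletCharacter.sum_char_inv_mul_char_eq ℂ ha (∏ i, x i), sum_mul]
    exact sum_congr rfl fun χ _ => by ring
  simp_rw [key]
  rw [hyperKloosterman, sum_filter, mul_sum]
  refine sum_congr rfl fun x _ => ?_
  by_cases h : ∏ i, x i = a
  · rw [if_pos h, if_pos h.symm]
  · rw [if_neg h, if_neg (Ne.symm h), zero_mul, mul_zero]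

end General

/-! ### The prime-field corollary: removing the trivial character (`g(ψ,1) = −1`) -/

section Prime

variable {p : ℕ} [Fact p.Prime]

/-- **The «Gauss-count rule» at a prime (proved):** for a NON-trivial additive character `ψ` of `𝔽_p`, a unit `a`
and every `n`, `Σ_{χ ≠ 1} g(ψ,χ)ⁿ · χ(a⁻¹) = (p − 1) · Klₙ(ψ; a) − (−1)ⁿ` — Katz's line 2 minus the trivial
character's term `g(ψ,1)ⁿ·1(a⁻¹) = (−1)ⁿ` (`gaussSum_one_left`). So a family average of a product of `n ≥ 1` Gauss
sums against `χ̄(a)` is a hyper-Kloosterman sum of `n` variables (weight `n − 1`, Katz Thm 4.1.1 (1) — not used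
here) up to a bounded correction. [cite: Katz1988, Ch. 4 §4.0, p. 43 table line 2] -/
theorem sum_ne_one_gaussSum_pow_mul_inv {ψ : AddChar (ZMod p) ℂ} (hψ : ψ ≠ 1) (n : ℕ) {a : ZMod p}
    (ha : IsUnit a) :
    ∑ χ ∈ (univ : Finset (DirichletCharacter ℂ p)).erase 1, gaussSum χ ψ ^ n * χ a⁻¹ =
      ((p : ℂ) - 1) * hyperKloosterman n ψ a - (-1) ^ n := by
  classical
  rw [sum_erase_eq_sub (mem_univ _), sum_gaussSum_pow_mul_inv ψ n ha, gaussSum_one_left hψ,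
    Nat.totient_prime Fact.out]
  have hp : 1 ≤ p := (Fact.out : p.Prime).one_lt.le
  have h1 : (1 : DirichletCharacter ℂ p) a⁻¹ = 1 := by
    obtain ⟨u, rfl⟩ := ha
    rw [← Units.val_inv_eq_inv_val, MulChar.one_apply_coe]
  rw [h1, mul_one]
  push_cast [Nat.cast_sub hp]
  ring

/-- The same corollary for `ψ = e(·/p)`. [cite: Katz1988, Ch. 4 §4.0, p. 43 table line 2] -/
theorem sum_ne_one_gaussSum_stdAddChar_pow_mul_inv (n : ℕ) {a : ZMod p} (ha : IsUnit a) :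
    ∑ χ ∈ (univ : Finset (DirichletCharacter ℂ p)).erase 1, gaussSum χ ZMod.stdAddChar ^ n * χ a⁻¹ =
      ((p : ℂ) - 1) * hyperKloosterman n ZMod.stdAddChar a - (-1) ^ n :=
  sum_ne_one_gaussSum_pow_mul_inv stdAddChar_ne_one n ha

end Prime

end Literature.NumberTheory.GaussSums

end
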